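import Summits.QuantumFields.YangMills.Theorems.LuscherReductionTwistedTraceScalingPointwiseSuper
import HarnessLib

/-!
# The pointwise super-solution bound for the RICCATI-weighted covariant stiff Gaussian: all weight hypotheses discharged
# (covariant programme, brick c4(iii) — upper direction, concrete weight)

Cell `ym-fleet`, crux `TwistedTraceScaling` (stmt-QuantumFields-20203), line «twolattice», stub S-BASE, lane B = COARSE-LOWER(L₁)
(design note `pub/ym-fleet/ym-20203-coarse-s1/LOWER-BLUEPRINT.md` §5–§6).  HONEST FRAMING: fixed-lattice bookkeeping; the cut-off `χ(S ≤ σ)`, the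
zero-mode factor `F₀`, the valley and the large field are NOT here; measurability of the trial state is still a HYPOTHESIS (brick (m5));
a stub of a child of the CONDITIONAL reduction route (femto rung R2b1); not a gap, not Clay.

With the programme's weight `g = Harm.riccatiWeight t b' μ_*` (`t = β/2`, `b' = β(1+ρ²)⁻²`, spectral floor `μ_* > 0`; EXACTLY Riccati w.r.t. the
kinetic constant `b'` on stiff modes `λ ≥ μ_*`, below the Riccati envelope everywhere) the hypotheses of `Cov.transferApply_stiffTrial_le` are
discharged by `…SpectralWeightBounds` (`riccatiWeight_nonneg/le/mul_le/sq_le`, `abs_riccatiWeight_sub_le`), every gain `κᵢ ≥ 0`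
(`Harm.stepGain_nonneg_of_le`), and the bound becomes

* ★★★ `transferApply_riccatiTrial_le` —
  `(K_β H)(U) ≤ (2π²)^{−|E|} e^{2β|E|} e^{(β/2)(η₁+θ)} e^{E} · Λ(U) · H(U) + e^{2β|E|} e^{−2βδ}`,
  `Λ(U) = Πᵢ √(π/(tλᵢ(U) + b' + g(λᵢ(U))λᵢ(U)²))` the normal-mode normalisation at `U`, `E = trialErr ρ σ N n (ĝ/μ_*) ĝ (3t/μ_*² + 3b'/μ_*³)`,
  `ĝ = √(t² + 2tb'/μ_*)`.

## References
* M. Lüscher, Nucl. Phys. B219 (1983) 233, §3. [Luscher1983]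
* A. Wipf, LNP 992 (2021), §8.5. [Wipf2021]
-/

noncomputable section

open MeasureTheory Real
open scoped RealInnerProductSpace
open Literature.MathematicalPhysics.QuantumFieldTheory
open Literature.MathematicalPhysics.QuantumLattice

namespace Summit.QuantumFields.YangMills.Theorems.FemtoTransferGap.TwoLattice.Cov

open Summit.QuantumFields.YangMills.Theorems.FemtoTransferGap
open Summit.QuantumFields.YangMills.Theorems.FemtoTransferGap.TwoLattice
open Summit.QuantumFields.YangMills.Theorems.FemtoTransferGap.TwoLattice.Stiff
open Summit.QuantumFields.YangMills.Theorems.FemtoTransferGap.TwoLattice.GnChart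
open Summit.QuantumFields.YangMills.Theorems.FemtoTransferGap.TwoLattice.Harm

variable {L : ℕ} [NeZero L]

/-- With a weight below the `b'`-Riccati envelope the gain factors are `≤ 1`:
`Πᵢ √(π/s'ᵢ) e^{−κᵢ xᵢ²} ≤ Πᵢ √(π/s'ᵢ)`. [cite: Wipf2021, §8.5.1 (8.57)] -/
theorem prod_gain_le {ι : Type*} [Fintype ι] {lam : ι → ℝ} {t b : ℝ} {g : ℝ → ℝ} (hlam : ∀ i, 0 ≤ lam i) (ht : 0 ≤ t) (hb : 0 < b)
    (hg0 : ∀ s, 0 ≤ g s) (henv : ∀ i, (g (lam i) * lam i ^ 2) ^ 2 ≤ (t * lam i) ^ 2 + 2 * (t * lam i) * b) (x : ι → ℝ) :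
    ∏ i, Real.sqrt (π / (t * lam i + b + g (lam i) * lam i ^ 2)) * Real.exp (-(stepGain (lam i) t b (g (lam i)) * x i ^ 2)) ≤
      ∏ i, Real.sqrt (π / (t * lam i + b + g (lam i) * lam i ^ 2)) := by
  refine Finset.prod_le_prod (fun i _ => by positivity) fun i _ => ?_
  have hκ : 0 ≤ stepGain (lam i) t b (g (lam i)) := stepGain_nonneg_of_le (hlam i) ht hb (hg0 _) (henv i)
  have h1 : Real.exp (-(stepGain (lam i) t b (g (lam i)) * x i ^ 2)) ≤ 1 := by
    rw [Real.exp_le_one_iff, neg_nonpos]; positivity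
  exact mul_le_of_le_one_right (Real.sqrt_nonneg _) h1

/-- ★★★ **POINTWISE SUPER-SOLUTION BOUND, RICCATI WEIGHT.**  For `β > 0`, `δ < 1`, `0 ≤ ρ ≤ 1/100`, `(1−δ)⁻² − 1 ≤ ρ²`, `σ ≤ 1/16`, `μ_* > 0`,
`g = riccatiWeight (β/2) (β(1+ρ²)⁻²) μ_*`, `H = stiffTrial g` measurable, `S(U) ≤ σ`:
`(K_β H)(U) ≤ (2π²)^{−|E|} e^{2β|E|} e^{(β/2)(η₁+θ)} e^{E} · Πᵢ √(π/(tλᵢ + b' + g(λᵢ)λᵢ²)) · H(U) + e^{2β|E|} e^{−2βδ}`.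
[cite: Luscher1983, §3] [cite: Wipf2021, §8.5.2] -/
theorem transferApply_riccatiTrial_le {β δ ρ σ μ : ℝ} (hβ : 0 < β) (hδ : δ < 1) (hρ0 : 0 ≤ ρ) (hρ : ρ ≤ 1 / 100)
    (hρδ : ((1 - δ) ^ 2)⁻¹ - 1 ≤ ρ ^ 2) (hσ : σ ≤ 1 / 16) (hμ : 0 < μ)
    (hH : Measurable (stiffTrial (L := L) (riccatiWeight (β / 2) (β / (1 + ρ ^ 2) ^ 2) μ))) (U : GaugeConfig 3 L SU2)
    (hS : wilsonAction su2Rep U ≤ σ) :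
    transferApply β (stiffTrial (riccatiWeight (β / 2) (β / (1 + ρ ^ 2) ^ 2) μ)) U ≤
      ((2 * π ^ 2)⁻¹) ^ Fintype.card (Edge 3 L) * Real.exp (2 * β) ^ Fintype.card (Edge 3 L) *
          Real.exp (β / 2 * (stepErrLo ρ σ (Fintype.card (Plaquette 3 L × Fin 3)) + chartErr ρ σ (Fintype.card (Plaquette 3 L × Fin 3)))) *
          Real.exp (trialErr ρ σ (Fintype.card (Plaquette 3 L × Fin 3)) (Fintype.card (Edge 3 L × Fin 3))
            (Real.sqrt ((β / 2) ^ 2 + 2 * (β / 2) * (β / (1 + ρ ^ 2) ^ 2) / μ) / μ)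
            (Real.sqrt ((β / 2) ^ 2 + 2 * (β / 2) * (β / (1 + ρ ^ 2) ^ 2) / μ))
            (3 * (β / 2) / μ ^ 2 + 3 * (β / (1 + ρ ^ 2) ^ 2) / μ ^ 3)) *
          (∏ i, Real.sqrt (π / (β / 2 * (gramMatrix_isHermitian (covCurl U)).eigenvalues i + β / (1 + ρ ^ 2) ^ 2 +
              riccatiWeight (β / 2) (β / (1 + ρ ^ 2) ^ 2) μ ((gramMatrix_isHermitian (covCurl U)).eigenvalues i) *
                (gramMatrix_isHermitian (covCurl U)).eigenvalues i ^ 2))) *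
          stiffTrial (riccatiWeight (β / 2) (β / (1 + ρ ^ 2) ^ 2) μ) U +
        Real.exp (2 * β) ^ Fintype.card (Edge 3 L) * Real.exp (-(2 * β * δ)) := by
  set t : ℝ := β / 2 with ht
  set b' : ℝ := β / (1 + ρ ^ 2) ^ 2 with hb'
  set g := riccatiWeight t b' μ
  have ht0 : 0 < t := by positivity
  have hb0 : 0 < b' := by positivity
  -- weight hypotheses
  have hg0 : ∀ s, 0 ≤ g s := fun s => riccatiWeight_nonneg hμ s
  have hgm : ∀ s, g s ≤ Real.sqrt (t ^ 2 + 2 * t * b' / μ) / μ := fun s => riccatiWeight_le hμ ht0.le hb0.le s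
  have hgm₁ : ∀ s, 0 ≤ s → g s * s ≤ Real.sqrt (t ^ 2 + 2 * t * b' / μ) := fun s hs => riccatiWeight_mul_le hμ ht0.le hb0.le hs
  have hL : 0 ≤ 3 * t / μ ^ 2 + 3 * b' / μ ^ 3 := by positivity
  have hLip : ∀ s s', |g s - g s'| ≤ (3 * t / μ ^ 2 + 3 * b' / μ ^ 3) * |s - s'| := fun s s' => abs_riccatiWeight_sub_le hμ ht0 hb0.le s s'
  have hmain := transferApply_stiffTrial_le hβ hδ hρ0 hρ hρδ hσ hg0 hgm hgm₁ hL hLip hH U hS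
  refine hmain.trans (add_le_add (mul_le_mul_of_nonneg_right (mul_le_mul_of_nonneg_left ?_ (by positivity))
    (stiffTrial_pos _ U).le) le_rfl)
  exact prod_gain_le (fun i => gram_eigenvalues_nonneg (covCurl U) i) ht0.le hb0 hg0
    (fun i => riccatiWeight_sq_le hμ ht0.le hb0.le (gram_eigenvalues_nonneg (covCurl U) i)) _

end Summit.QuantumFields.YangMills.Theorems.FemtoTransferGap.TwoLattice.Cov

end
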